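import Literature.AnabelianGeometry.EtaleTheta.RemarksSec3Proofs
import HarnessLib

/-!
# Frobenioids II, §0 p. 5: a Frobenioid over a base of weakly indissectible / strongly dissectible /
# weakly dissectible type is itself of that type — PROVED for the model Frobenioids of [FrdI] Thm. 5.2 (i)

Mochizuki, *The geometry of Frobenioids II: poly-Frobenioids*, Kyushu J. Math. **62** (2008) 401–460,
§0 "Notations and Conventions", paragraph **Categories**, kurims text p. 5 l. 20–24
[cite: MochizukiFrdII2008, §0 p.5]: "Observe that by considering appropriate pre-steps and pull-back
morphisms as in [Mzk5], Definition 1.3, (i), (b), (c), it follows immediately that [the underlying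
category of] any Frobenioid over a base category of weakly indissectible (respectively, strongly
dissectible; weakly dissectible) type is itself of weakly indissectible (respectively, strongly
dissectible; weakly dissectible) type."  This is the one ASSERTION of the §0 conventions block; the
vocabulary file `Dissection.lean` (abc-iut-L1-t4) deliberately left it to the Frobenioid files, and
[EtTh] Rmk. 3.7.1 "recalls" it for tempered Frobenioids (`TemperedFrobenioid.remark371_holds`,
`RemarksSec3Proofs.lean`, abc-iut-w5-d135).

PROOF-ONLY file (theorems only; abc-iut cell, seat abc-iut-f-031): the observation PROVED for the MODEL
FROBENIOID `ModelFrobenioid Φ B DivB` of [FrdI] Thm. 5.2 (i) (Mochizuki, *The geometry of Frobenioids I*,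
Kyushu J. Math. **62** (2008), Thm. 5.2 p. 100 [cite: MochizukiFrdI2008, Thm. 5.2(i) p.100]) on ARBITRARY
data `(D, Φ, B, Div_B : B → Φ^gp)` — every Frobenioid is equivalent to the model Frobenioid of its data
([FrdI] Thm. 5.2 (ii)), and the tempered Frobenioids of [EtTh] Def. 3.6 are literally such model
categories, so the three theorems below specialise to w5-d135's tempered-only
`TemperedFrobenioid.isOfWeaklyIndissectibleType_category` / `…StronglyDissectible…` /
`…WeaklyDissectible…`, whose (already base-general) LIFTING lemmas `ModelFrobenioid.exists_lift_pair`,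
`ModelFrobenioid.exists_nonempty_over` carry the argument: a pair of arrows `Yᵢ → Base(A)` of `D` lifts
to a pair of degree-`1` arrows `(Yᵢ, 1/bᵢ) → A` with NON-INITIAL (indeed mobile) domains, arrows
`Z → Xᵢ` project to `Base(Z) → Yᵢ`, and equal composites project to equal composites.  Hypotheses:
NONE for the weakly-indissectible clause; `D` totally epimorphic ([FrdI] §0; a standing hypothesis on
the base of a Frobenioid, [FrdI] Def. 1.3) for the two dissectible clauses, where it supplies "a
non-initial object only maps to non-initial objects" (`IsTotallyEpimorphic.isNonemptyObj_of_hom`).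
(Layering note: the file imports the [EtTh]-side proof file only for those two `ModelFrobenioid`
lemmas, which live in the `Frobenioids` namespace.)  Elementary; nothing here bears on the disputed
[IUTchIII] Cor. 3.12 or takes a side; no statement of the paper is strengthened.
-/

namespace Literature.AlgebraicGeometry.Frobenioids

namespace ModelFrobenioid

open CategoryTheory CategoryTheory.Limits Opposite

universe w v u

variable {D : Type u} [Category.{v} D] {Φ B : Dᵒᵖ ⥤ CommMonCat.{w}} {DivB : B ⟶ monoidGp Φ}

/-- **[FrdII] §0 p. 5, first clause, for model Frobenioids:** if the base `D` is of weakly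
indissectible type, then so is the model Frobenioid `ModelFrobenioid Φ B DivB` of [FrdI] Thm. 5.2 (i)
— over ANY base (no hypothesis on `D`, `Φ`, `B` is used): a strongly dissecting pair `Xᵢ → A` would
project to a strongly dissecting pair `Base(Xᵢ) → Base(A)`, because two arrows `W → Base(X₀)`,
`W → Base(X₁)` lift to arrows out of a common non-initial object (`exists_nonempty_over`).
[cite: MochizukiFrdII2008, §0 p.5] -/
theorem isOfWeaklyIndissectibleType_of_base (hD : IsOfWeaklyIndissectibleType D) :
    IsOfWeaklyIndissectibleType (ModelFrobenioid Φ B DivB) := by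
  refine ⟨fun A => ?_⟩
  rintro ⟨X, φ, -, hXsd⟩
  have key : ∀ W : D, (W ⟶ (X 0).base) → (W ⟶ (X 1).base) → False := by
    intro W f₀ f₁
    obtain ⟨Z, hZ, hZ₀, hZ₁⟩ := exists_nonempty_over (X 0) (X 1) f₀ f₁
    exact hXsd (show (0 : Fin 2) ≠ 1 by decide) hZ ⟨hZ₀, hZ₁⟩
  refine hD.isWeaklyIndissectible A.base
    ⟨fun i => (X i).base, fun i => baseMap (φ i), fun i => ⟨fun hI => ?_⟩, ?_⟩
  · exact key _ (hI.to _) (hI.to _)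
  · rintro i j hij W - ⟨⟨fi⟩, ⟨fj⟩⟩
    fin_cases i <;> fin_cases j
    · exact hij rfl
    · exact key W fi fj
    · exact key W fj fi
    · exact hij rfl

/-- Over a totally epimorphic base of strongly dissectible type, every `Base(Z)` is non-initial, for
every object `Z` of the model Frobenioid. [cite: MochizukiFrdII2008, §0 p.5] -/
theorem isNonemptyObj_base_of_isOfStronglyDissectibleType (hDe : IsTotallyEpimorphic D)
    (hD : IsOfStronglyDissectibleType D) (Z : ModelFrobenioid Φ B DivB) : IsNonemptyObj Z.base :=
  hDe.isNonemptyObj_of_isOfStronglyDissectibleType hD Z.base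

/-- Over a totally epimorphic base of weakly dissectible type, every `Base(Z)` is non-initial, for
every object `Z` of the model Frobenioid. [cite: MochizukiFrdII2008, §0 p.5] -/
theorem isNonemptyObj_base_of_isOfWeaklyDissectibleType (hDe : IsTotallyEpimorphic D)
    (hD : IsOfWeaklyDissectibleType D) (Z : ModelFrobenioid Φ B DivB) : IsNonemptyObj Z.base :=
  hDe.isNonemptyObj_of_isOfWeaklyDissectibleType hD Z.base

/-- **[FrdII] §0 p. 5, second clause, for model Frobenioids:** if the base `D` is totally epimorphic
([FrdI] §0, Def. 1.3) and of strongly dissectible type, then the model Frobenioid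
`ModelFrobenioid Φ B DivB` of [FrdI] Thm. 5.2 (i) is of strongly dissectible type: a strongly dissecting
pair `Yᵢ → Base(A)` lifts to degree-`1` arrows `(Yᵢ, 1/bᵢ) → A` with non-initial domains
(`exists_lift_pair`), and arrows `Z → Xᵢ` project to `Base(Z) → Yᵢ` with `Base(Z)` non-initial.
[cite: MochizukiFrdII2008, §0 p.5] -/
theorem isOfStronglyDissectibleType_of_base (hDe : IsTotallyEpimorphic D)
    (hD : IsOfStronglyDissectibleType D) : IsOfStronglyDissectibleType (ModelFrobenioid Φ B DivB) := by
  refine ⟨fun A => ?_⟩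
  obtain ⟨Y, g, -, hYsd⟩ := hD.isStronglyDissectible A.base
  obtain ⟨X, φ, hXne, hXb, -⟩ := exists_lift_pair A Y g
  refine ⟨X, φ, hXne, ?_⟩
  rintro i j hij Z - ⟨⟨ψi⟩, ⟨ψj⟩⟩
  exact hYsd hij (isNonemptyObj_base_of_isOfStronglyDissectibleType hDe hD Z)
    ⟨hXb i Z ψi, hXb j Z ψj⟩

/-- **[FrdII] §0 p. 5, third clause, for model Frobenioids:** if the base `D` is totally epimorphic
and of weakly dissectible type, then the model Frobenioid `ModelFrobenioid Φ B DivB` of [FrdI] Thm. 5.2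
(i) is of weakly dissectible type: a weakly dissecting pair `Yᵢ → Base(A)` lifts to degree-`1` arrows
`(Yᵢ, 1/bᵢ) → A` with non-initial domains, and an equality `ψ₀ ≫ φ₀ = ψ₁ ≫ φ₁` projects to one in
`D` out of the non-initial `Base(Z)`. [cite: MochizukiFrdII2008, §0 p.5] -/
theorem isOfWeaklyDissectibleType_of_base (hDe : IsTotallyEpimorphic D)
    (hD : IsOfWeaklyDissectibleType D) : IsOfWeaklyDissectibleType (ModelFrobenioid Φ B DivB) := by
  refine ⟨fun A => ?_⟩
  obtain ⟨Y, g, -, hYwd⟩ := hD.isWeaklyDissectible A.base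
  obtain ⟨X, φ, hXne, -, hXeq⟩ := exists_lift_pair A Y g
  refine ⟨X, φ, hXne, ?_⟩
  intro i j hij Z _ ψi ψj heq
  obtain ⟨χi, χj, hχ⟩ := hXeq i j Z ψi ψj heq
  exact hYwd hij (isNonemptyObj_base_of_isOfWeaklyDissectibleType hDe hD Z) χi χj hχ

/-- **[FrdII] §0 p. 5 l. 20–24, the observation as printed (three clauses), for the model Frobenioid of
[FrdI] Thm. 5.2 (i) over a totally epimorphic base `D`.** [cite: MochizukiFrdII2008, §0 p.5] -/
theorem dissectionTypes_of_base (hDe : IsTotallyEpimorphic D) :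
    (IsOfWeaklyIndissectibleType D → IsOfWeaklyIndissectibleType (ModelFrobenioid Φ B DivB)) ∧
    (IsOfStronglyDissectibleType D → IsOfStronglyDissectibleType (ModelFrobenioid Φ B DivB)) ∧
    (IsOfWeaklyDissectibleType D → IsOfWeaklyDissectibleType (ModelFrobenioid Φ B DivB)) :=
  ⟨isOfWeaklyIndissectibleType_of_base, isOfStronglyDissectibleType_of_base hDe,
    isOfWeaklyDissectibleType_of_base hDe⟩

end ModelFrobenioid

end Literature.AlgebraicGeometry.Frobenioids

-- Consistency (not re-declared — the gate's dedup rule): [EtTh] Rmk. 3.7.1, `TemperedFrobenioid.remark371_holds`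
-- (RemarksSec3Proofs.lean, F-1309), has literally the type of
-- `ModelFrobenioid.dissectionTypes_of_base C₀.isTotallyEpimorphic` at the tempered Frobenioid's model
-- category `C₀.category` (Def. 3.6 (ii)); checked on the farm before filing.
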